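import Summits.HodgeConjecture.HodgeConjecture.Theses.LinearSystemTorelli
import Literature.AlgebraicGeometry.HodgeTheory.MiddleDimensionReductionOfHodgeModels
import Literature.AlgebraicGeometry.HodgeTheory.MiddleDimensionReductionHolds
import Literature.AlgebraicGeometry.HodgeTheory.HypersurfaceSectionLefschetz
import Literature.AlgebraicGeometry.HodgeTheory.SupportedClassesHodgeConiveau
import Literature.AlgebraicGeometry.HodgeTheory.AlgebraicClassesCup
import Literature.AlgebraicGeometry.HodgeTheory.AmbientClassesMoving
import Literature.AlgebraicGeometry.HodgeTheory.HypersurfaceLefschetzUpper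
import Literature.AlgebraicGeometry.HodgeTheory.GysinBaseChange
import Literature.AlgebraicGeometry.HodgeTheory.ComplexGysinRational
import Literature.AlgebraicGeometry.HodgeTheory.RationalClassesRingChange
import Literature.AlgebraicGeometry.HodgeTheory.GysinHodgeClassLiftProofs
import Literature.AlgebraicGeometry.Motives.UniversalHyperplaneSection
import Literature.AlgebraicGeometry.Motives.ProjectiveSpaceFieldPointsBijective
import Literature.AlgebraicGeometry.Motives.ComplexPointsOpenDense
import Literature.AlgebraicGeometry.Motives.VarietiesGeometricallyIntegralProofs
import Literature.Topology.FourManifolds.ComplexProjectiveSpaceHomologyProofs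
import Summits.HodgeConjecture.HodgeConjecture.Theorems.PadicSemiregularLiftHodgeBeyondAnchorsProductsNotAnchors
import Summits.HodgeConjecture.HodgeConjecture.Theorems.LinearSystemTorelliPencilReductionTopology

/-!
# Route LinearSystemTorelli — `PencilReduction` (item stmt-HodgeConjecture-1083): hyperplanes in general position

Helper file of the conditional assembly `LinearSystemTorelliPencilReduction`: every non-empty open set of
the dual projective space contains the point of a hyperplane `[a]`; the hyperplanes through the image of a
given scheme point of `X` are avoided on a non-empty open set (a proper linear subspace of coefficient
vectors, cut by a dual linear form); and a closed subset of a Noetherian scheme has finitely many points of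
a given minimal codimension (copied from the tree's private lemma of `MiddleDimensionReductionProofs`).
Everything is proved.
-/

noncomputable section

open scoped Manifold ContDiff
open CategoryTheory CategoryTheory.Limits AlgebraicGeometry MonoidalCategory CartesianMonoidalCategory
open Literature.AlgebraicTopology.SingularHomology
open Literature.AlgebraicGeometry Literature.AlgebraicGeometry.Motives Literature.AlgebraicGeometry.HodgeTheory

set_option linter.dupNamespace false

namespace Summit.HodgeConjecture.HodgeConjecture.Theorems

/-! ### General position of a hyperplane with respect to finitely many points -/

/-- Every non-empty open subset of `ℙᴺ_ℂ` contains the point of a complex point `[a]`, `a ≠ 0`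
(closed points are dense and are complex points — Nullstellensatz; every complex point has homogeneous
coordinates). [cite: GortzWedhorn2020, Prop. 3.35] [cite: Hartshorne1977, II Ex. 2.14] -/
theorem exists_pointOfVec_pt_mem {N : ℕ} {V : Set (projectiveSpace N ℂ).left} (hV : IsOpen V)
    (hne : V.Nonempty) : ∃ (a : Fin (N + 1) → ℂ) (ha : a ≠ 0), (ProjectiveSpace.pointOfVec ℂ a ha).pt ∈ V := by
  haveI : LocallyOfFiniteType (projectiveSpace N ℂ).hom :=
    locallyOfFiniteType_of_isSmoothProjective (isSmoothProjective_projectiveSpace_holds ℂ N)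
  haveI : JacobsonSpace ↥(projectiveSpace N ℂ).left := LocallyOfFiniteType.jacobsonSpace (projectiveSpace N ℂ).hom
  obtain ⟨x, hxV, hxc⟩ := nonempty_inter_closedPoints hne hV.isLocallyClosed
  set Q := (ComplexPoints.equivClosedPoints (projectiveSpace N ℂ)).symm ⟨x, hxc⟩ with hQ
  have hpt : Q.pt = x := by
    have := ComplexPoints.coe_equivClosedPoints_apply (projectiveSpace N ℂ) Q
    rw [hQ, Equiv.apply_symm_apply] at this
    exact this.symm
  obtain ⟨a, ha, hQa⟩ := ProjectiveSpace.exists_eq_pointOfVec Q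
  exact ⟨a, ha, by rw [← hQa, hpt]; exact hxV⟩

/-- **A hyperplane in general position misses a given point.** For `e : X ↪ ℙᴺ_ℂ` and a (scheme)
point `z` of `X`, the hyperplanes `H_a = V₊(Σ aᵢ xᵢ)` through `e(z)` — i.e. with `z ∈ X ∩ H_a` — are
avoided on a non-empty open set of the dual projective space: the coefficient vectors `a` with
`Σ aᵢ xᵢ ∈ 𝔭_{e(z)}` form a proper linear subspace (not all `xᵢ` lie in the relevant prime `𝔭_{e(z)}`),
killed by a non-zero linear form `g`, and `D₊(g)` works. [cite: Hartshorne1977, I Ex. 1.8 and II Prop. 2.5] -/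
theorem exists_isOpen_forall_notMem_range_hypersurfaceSectionι {X : SchemeOver ℂ} (e : ProjectiveEmbedding X)
    (z : X.left) : ∃ V : Set (projectiveSpace e.n ℂ).left, IsOpen V ∧ V.Nonempty ∧
      ∀ (a : Fin (e.n + 1) → ℂ) (ha : a ≠ 0), (ProjectiveSpace.pointOfVec ℂ a ha).pt ∈ V →
        z ∉ Set.range (e.hypersurfaceSectionι (∑ i, MvPolynomial.C (a i) * MvPolynomial.X i) (isHomogeneous_linForm a)).left.base := by
  classical
  letI : GradedAlgebra (MvPolynomial.homogeneousSubmodule (Fin (e.n + 1)) ℂ) := MvPolynomial.gradedAlgebra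
  set y := e.toProj.base z with hy
  -- the coefficient vectors of the linear forms in `𝔭_y`: a linear subspace
  let Lmap : (Fin (e.n + 1) → ℂ) →ₗ[ℂ] MvPolynomial (Fin (e.n + 1)) ℂ :=
    Fintype.linearCombination ℂ (fun i ↦ MvPolynomial.X i)
  have hLmap : ∀ a, Lmap a = (∑ i, MvPolynomial.C (a i) * MvPolynomial.X i) := fun a ↦ by
    simp only [Lmap, Fintype.linearCombination_apply, MvPolynomial.smul_eq_C_mul]
  let Lz : Submodule ℂ (Fin (e.n + 1) → ℂ) := (y.asHomogeneousIdeal.toIdeal.restrictScalars ℂ).comap Lmap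
  have hLz_mem : ∀ a, a ∈ Lz ↔ (∑ i, MvPolynomial.C (a i) * MvPolynomial.X i) ∈ y.asHomogeneousIdeal := fun a ↦ by
    rw [Submodule.mem_comap, Submodule.restrictScalars_mem, hLmap]
    rfl
  -- `Lz ≠ ⊤`: otherwise every `xᵢ` lies in `𝔭_y`, which would contain the irrelevant ideal
  have hLz : Lz < ⊤ := by
    refine lt_top_iff_ne_top.2 fun htop ↦ y.not_irrelevant_le ?_
    intro f hf
    have hX : ∀ i : Fin (e.n + 1), (MvPolynomial.X i : MvPolynomial (Fin (e.n + 1)) ℂ) ∈ y.asHomogeneousIdeal := by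
      intro i
      have hmem : (Pi.single i (1 : ℂ) : Fin (e.n + 1) → ℂ) ∈ Lz := by rw [htop]; exact Submodule.mem_top
      have hlin : (∑ j, MvPolynomial.C ((Pi.single i (1 : ℂ) : Fin (e.n + 1) → ℂ) j) * MvPolynomial.X j) = MvPolynomial.X i := by
        rw [Finset.sum_eq_single i (fun j _ hj ↦ by rw [Pi.single_eq_of_ne hj, MvPolynomial.C_0, zero_mul])
          (fun h ↦ (h (Finset.mem_univ i)).elim), Pi.single_eq_same, MvPolynomial.C_1, one_mul]
      have := (hLz_mem _).1 hmem
      rwa [hlin] at this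
    have hspan : Ideal.span (Set.range (MvPolynomial.X : Fin (e.n + 1) → MvPolynomial (Fin (e.n + 1)) ℂ)) ≤
        y.asHomogeneousIdeal.toIdeal := Ideal.span_le.2 (by rintro _ ⟨i, rfl⟩; exact hX i)
    exact hspan (Segre.irrelevant_le_span_X (Fin (e.n + 1)) ℂ hf)
  obtain ⟨g, hg0, hgker⟩ := Submodule.exists_le_ker_of_lt_top Lz hLz
  -- the linear form `g` as a homogeneous polynomial of degree one in the dual coordinates
  set G : MvPolynomial (Fin (e.n + 1)) ℂ := (∑ j, MvPolynomial.C (g (Pi.single j 1)) * MvPolynomial.X j) with hG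
  have hGhom : G ∈ MvPolynomial.homogeneousSubmodule (Fin (e.n + 1)) ℂ 1 := isHomogeneous_linForm _
  have haeval : ∀ a : Fin (e.n + 1) → ℂ, MvPolynomial.aeval a G = g a := by
    intro a
    have ha : a = ∑ i, a i • (Pi.single i (1 : ℂ) : Fin (e.n + 1) → ℂ) := by
      ext j
      simp [Finset.sum_apply, Pi.single_apply]
    conv_rhs => rw [ha]
    simp only [hG, map_sum, map_mul, MvPolynomial.aeval_C, MvPolynomial.aeval_X, map_smul, smul_eq_mul,
      Algebra.algebraMap_self_apply]
    exact Finset.sum_congr rfl fun i _ ↦ mul_comm _ _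
  obtain ⟨a₀, ha₀⟩ : ∃ a₀, g a₀ ≠ 0 := by simpa using DFunLike.ne_iff.1 hg0
  have ha₀0 : a₀ ≠ 0 := by rintro rfl; exact ha₀ (map_zero g)
  let O : TopologicalSpace.Opens ↥(projectiveSpace e.n ℂ).left :=
    Proj.basicOpen (MvPolynomial.homogeneousSubmodule (Fin (e.n + 1)) ℂ) G
  refine ⟨(O : Set ↥(projectiveSpace e.n ℂ).left), O.isOpen, ⟨(ProjectiveSpace.pointOfVec ℂ a₀ ha₀0).pt, ?_⟩,
    fun a ha hmem hz ↦ ?_⟩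
  · exact (ProjectiveSpace.pt_pointOfVec_mem_basicOpen_iff a₀ ha₀0 one_pos hGhom).2 (by rw [haeval]; exact ha₀)
  have hga : g a ≠ 0 := by
    rw [← haeval]
    exact (ProjectiveSpace.pt_pointOfVec_mem_basicOpen_iff a ha one_pos hGhom).1 hmem
  have haL : a ∉ Lz := fun h ↦ hga (LinearMap.mem_ker.1 (hgker h))
  refine haL ((hLz_mem a).2 ?_)
  rw [range_hypersurfaceSectionι e (∑ i, MvPolynomial.C (a i) * MvPolynomial.X i) (isHomogeneous_linForm a) one_pos] at hz
  have hz' : y ∈ ProjectiveSpectrum.zeroLocus _ {(∑ i, MvPolynomial.C (a i) * MvPolynomial.X i)} := hz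
  have hsub : ({(∑ i, MvPolynomial.C (a i) * MvPolynomial.X i)} : Set (MvPolynomial (Fin (e.n + 1)) ℂ)) ⊆ y.asHomogeneousIdeal := hz'
  exact hsub (Set.mem_singleton _)

/-- A specialisation `ζ ⤳ x` with `coheight x ≤ coheight ζ < ∞` is trivial. [folklore] -/
theorem eq_of_specializes_of_coheight_le' {S : Scheme} {ζ x : S} (h : ζ ⤳ x)
    (hfin : Order.coheight x ≠ ⊤) (hle : Order.coheight x ≤ Order.coheight ζ) : ζ = x := by
  by_contra hne
  have hlt : x < ζ := lt_of_le_not_ge (Scheme.le_iff_specializes.mpr h) fun h' ↦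
    hne (Specializes.antisymm h (Scheme.le_iff_specializes.mp h')).eq
  have h1 := Order.coheight_add_one_le hlt
  have hζ : Order.coheight ζ ≠ ⊤ := fun e ↦ hfin (top_le_iff.mp (by simpa [e] using h1))
  obtain ⟨a, ha⟩ := ENat.ne_top_iff_exists.mp hζ
  obtain ⟨b, hb⟩ := ENat.ne_top_iff_exists.mp hfin
  rw [← ha, ← hb] at h1 hle
  have h1' : a + 1 ≤ b := by exact_mod_cast h1
  have h2' : b ≤ a := by exact_mod_cast hle
  omega

/-- In a Noetherian scheme a closed subset all of whose points have codimension `≥ p` contains only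
finitely many points of codimension exactly `p` (generic points of components). [folklore] -/
theorem finite_setOf_mem_and_coheight_eq' {S : Scheme} [TopologicalSpace.NoetherianSpace S]
    {Z : Set S} (hZ : IsClosed Z) {p : ℕ} (hZp : ∀ z ∈ Z, (p : ℕ∞) ≤ Order.coheight z) :
    {z | z ∈ Z ∧ Order.coheight z = p}.Finite := by
  obtain ⟨F, hFfin, hFcl, hFirr, hZF⟩ :=
    TopologicalSpace.NoetherianSpace.exists_finite_set_isClosed_irreducible hZ
  refine (hFfin.biUnion (t := fun t ↦ {g | IsGenericPoint g t}) fun t _ ↦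
    Set.Subsingleton.finite fun g hg g' hg' ↦ IsGenericPoint.eq hg hg').subset ?_
  rintro z ⟨hzZ, hzp⟩
  have hzZ' : z ∈ ⋃₀ F := hZF ▸ hzZ
  obtain ⟨t, htF, hzt⟩ := Set.mem_sUnion.mp hzZ'
  refine Set.mem_biUnion htF ?_
  have hg : IsGenericPoint (hFirr t htF).genericPoint t :=
    (hFirr t htF).isGenericPoint_genericPoint (hFcl t htF)
  have hgZ : (hFirr t htF).genericPoint ∈ Z := by
    rw [hZF]
    exact Set.mem_sUnion.mpr ⟨t, htF, hg.mem⟩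
  have hgz : (hFirr t htF).genericPoint = z :=
    eq_of_specializes_of_coheight_le' (hg.specializes hzt) (by rw [hzp]; exact ENat.coe_ne_top p)
      (by rw [hzp]; exact hZp _ hgZ)
  rw [← hgz]
  exact hg


end Summit.HodgeConjecture.HodgeConjecture.Theorems

end
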